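import Mathlib
import HarnessLib
import Summits.Langlands.Statement
import Summits.Langlands.Langlands.Theses.WachComponentCensus
import Literature.NumberTheory.GaloisRepresentations.PstCrystallineExtensionData
import Literature.NumberTheory.PAdicHodge.FontaineDpst

/-!
# Route `WachComponentCensus` — the PD chain (item `stmt-Langlands-14681`, informal `PDChain`)

TYPED GLUE for the informal assembly item `PDChain` of route `Langlands/WachComponentCensus`.
The item has no Lean statement in the route file (it is listed there as "informal only"); this
file supplies, and kernel-checks the composition of, the two typed hypotheses the route's text
describes:

* `hPD`  — the typed shape of the local thesis **PD2Unram** (item `stmt-Langlands-14643`) over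
  the summit's own pinned datum: for a number field `F`, a prime `p ≥ 5` with `p ∤ d_F`, a place
  `v ∣ p` (so `F_v/ℚ_p` is unramified — every finite unramified extension of `ℚ_p` arises this
  way) and ANY continuous `ρ_v : Γ_{F_v} → GL₂(ℚ̄_p)` which is crystalline for Fontaine's datum
  `fontainePstAdicCompletion v p hv` (= `RD.pst p v hv` for every `RD`, by `rfl`) with
  multiplicity-free labelled Hodge–Tate weights of cardinality `2` for every `ℚ_p`-embedding
  `τ : F_v → ℚ̄_p`, `ρ_v` is potentially diagonalizable relative to EVERY compatible crystalline
  extension datum `𝔈 : PstCrystallineExtensionData (fontainePstAdicCompletion v p hv)`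
  (`IsPotentiallyDiagonalizable 𝔈.𝔅 ρ_v`, BLGGT §1.4);
* `hLift` — the typed shape of **PDChain** itself, the in-print potentially-diagonalizable
  lifting package for `GL₂` over totally real `F` at `p ≥ 7` unramified in `F`: reciprocity data
  `RD` pinned by the cyclotomic Hodge–Tate weights and by the known direction (A)₂, such that every
  irreducible, geometric, odd `ρ : Γ_F → GL₂(ℚ̄_p)`, crystalline with regular labelled weights at
  every `v ∣ p`, with `ρ̄|Γ_{F(ζ_p)}` irreducible and `ρ̄` automorphic of regular weight, AND
  potentially diagonalizable at every `v ∣ p` (relative to every `𝔈` over `RD.pst p v hv`),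
  corresponds to an L-algebraic cuspidal `π` — i.e. the route target `LiftB2Unram` with the single
  extra hypothesis "PD at `v ∣ p`".  In print this is Barnet-Lamb–Gee–Geraghty–Taylor Thm. 4.2.1
  (arXiv:1010.2561; CM base field, `ℓ ≥ 2(n+1) = 6`, residual automorphy by a `π` of level
  potentially prime to `ℓ` which is PD at `v ∣ ℓ`) after base change to a CM quadratic extension
  and solvable descent (loc. cit. Cor. 4.5.2; BLGHT Lemmas 1.4–1.5), the PD automorphic lift of
  `ρ̄` being supplied by Barnet-Lamb–Gee–Geraghty, arXiv:1205.4491 Thm. 2.1.2 (a weight-`0`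
  ordinary, hence PD, modular lift after a solvable totally real base change; Gee–Kisin
  Lemma 4.4.1: potentially Barsotti–Tate ⇒ PD), plus local–global compatibility for Hilbert
  modular forms to pass from `ρ ≅ r_{ℓ,ι}(π)` to `Corresponds`.  It is a HYPOTHESIS here, not a
  fact: its `Corresponds`/`RD.pst` vocabulary is the summit's, so it cannot be a Literature fact.

Theorems (pure logic over the route decls, used BY NAME; the content is the exact typed shape of
the two hypotheses and the kernel check that they compose):
* `liftB2Unram_of_pdChain` : `hLift → hPD → LiftB2Unram` (the route's own description of its
  target: "`= PD2Unram + PD lifting (PDChain)`");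
* `liftB2UnramSmallF_of_liftB2Unram`, `liftB2UnramLargeF_of_liftB2Unram` : the two typed cruxes
  are the target with one hypothesis dropped, so `hLift ∧ hPD` also yields both cruxes and, with
  the remainder `SliceToLanglands`, the summit (through the route's deciding theorem `closes`).

No statement of the route file is altered and no definition is introduced.
Axioms: `propext`, `Classical.choice`, `Quot.sound`.
-/

set_option linter.dupNamespace false -- project-wide option; `Summit.Langlands.Langlands` is the mandated namespace

namespace Summit.Langlands.Langlands.Theorems

open IsDedekindDomain NumberField Field
open Literature.NumberTheory.GaloisRepresentations Literature.NumberTheory.Automorphic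
open Literature.NumberTheory.PAdicHodge
open Summit.Langlands.Langlands.Theses.WachComponentCensus

/-- **The PD chain, typed** (item `stmt-Langlands-14681`): the in-print potentially-diagonalizable
lifting package `hLift` (= the route target `LiftB2Unram` with the extra hypothesis "`ρ|Γ_{F_v}`
is potentially diagonalizable for every `v ∣ p`, relative to every compatible crystalline
extension datum over the pinned `RD.pst p v hv`") together with the typed local thesis `hPD`
(= `PD2Unram`: crystalline rank-`2` representations of unramified `F_v`, `p ≥ 5`, with regular
labelled Hodge–Tate weights are potentially diagonalizable for Fontaine's datum) give the route
target `LiftB2Unram`.  Pure logic: `RD.pst p v hv` is `fontainePstAdicCompletion v p hv` and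
`ρ.labelledHodgeTateWeightsAt v _ _ τ` is `labelledHodgeTateWeights (ρ.toLocal v).toGaloisRep τ`,
both by `rfl`. [cite: BarnetlambEtAl2014, §1.4 and Thm. 4.2.1] -/
theorem liftB2Unram_of_pdChain
    (hLift : ∀ (F : Type) [Field F] [NumberField F] [NumberField.IsTotallyReal F] (p : ℕ)
      [Fact p.Prime], 7 ≤ p → ¬ ((p : ℤ) ∣ NumberField.discr F) → ∃ RD : ReciprocityData F,
      (∀ (m : ℤ) (χ : FramedGaloisRep F (PadicAlgCl p) 1),
        (∀ σ, (χ σ).val 0 0 = algebraMap ℚ_[p] (PadicAlgCl p)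
          ((((GaloisRep.cyclotomicCharacter F p σ : ℤ_[p]ˣ) : ℤ_[p]) : ℚ_[p]) ^ m)) →
        ∀ (v : HeightOneSpectrum (𝓞 F)) (hv : ((p : ℕ) : 𝓞 F) ∈ v.asIdeal),
          let D := RD.pst p v hv; letI := D.algebra;
          ∀ τ : v.adicCompletion F →ₐ[ℚ_[p]] PadicAlgCl p,
            χ.labelledHodgeTateWeightsAt v D.algebra D.𝔅 τ.toRingHom = {-m}) ∧
      ∀ hcpt : isCompact_glFiniteIntegralLevel 2 F,
        (∀ π : CuspidalAutomorphicRepData 2 F hcpt, π.1.IsLAlgebraic →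
          (∃ T : InfinityType F 2, π.1.HasInfinityType T ∧ T.IsRegular) →
          ∀ (ℓ : ℕ) [Fact ℓ.Prime] (ι : PadicAlgCl ℓ ≃+* ℂ),
            ∃ ρ : FramedGaloisRep F (PadicAlgCl ℓ) 2,
              ρ.toGaloisRep.IsIrreducible ∧ IsGeometricFramed RD ρ ∧ Corresponds RD ι π.1 ρ) ∧
        (∀ (ι : PadicAlgCl p ≃+* ℂ) (ρ : FramedGaloisRep F (PadicAlgCl p) 2),
          ρ.toGaloisRep.IsIrreducible → IsGeometricFramed RD ρ → ρ.IsOdd →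
          (∀ (v : HeightOneSpectrum (𝓞 F)) (hv : ((p : ℕ) : 𝓞 F) ∈ v.asIdeal),
            let D := RD.pst p v hv;
            D.IsCrystallineFramed (ρ.toLocal v) ∧
              (letI := D.algebra; ∀ τ : v.adicCompletion F →ₐ[ℚ_[p]] PadicAlgCl p,
                let M := ρ.labelledHodgeTateWeightsAt v D.algebra D.𝔅 τ.toRingHom;
                M.Nodup ∧ Multiset.card M = 2)) →
          (¬ ∃ χ₁ χ₂ : absoluteGaloisGroup (CyclotomicField p F) →* (PadicAlgCl p)ˣ,
            IsOpen (χ₁.ker : Set (absoluteGaloisGroup (CyclotomicField p F))) ∧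
            IsOpen (χ₂.ker : Set (absoluteGaloisGroup (CyclotomicField p F))) ∧
            ∀ σ, ‖(ρ.restrictField (CyclotomicField p F) σ).val.trace -
              ((χ₁ σ : PadicAlgCl p) + (χ₂ σ : PadicAlgCl p))‖ < 1) →
          (∃ (π₀ : CuspidalAutomorphicRepData 2 F hcpt) (ρ₀ : FramedGaloisRep F (PadicAlgCl p) 2),
            π₀.1.IsLAlgebraic ∧ (∃ T : InfinityType F 2, π₀.1.HasInfinityType T ∧ T.IsRegular) ∧
            Corresponds RD ι π₀.1 ρ₀ ∧ ∀ σ, ‖(ρ σ).val.trace - (ρ₀ σ).val.trace‖ < 1) →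
          (∀ (v : HeightOneSpectrum (𝓞 F)) (hv : ((p : ℕ) : 𝓞 F) ∈ v.asIdeal)
            (𝔈 : PstCrystallineExtensionData (RD.pst p v hv)),
            letI := (RD.pst p v hv).algebra; IsPotentiallyDiagonalizable 𝔈.𝔅 (ρ.toLocal v)) →
          ∃ π : CuspidalAutomorphicRepData 2 F hcpt, π.1.IsLAlgebraic ∧ Corresponds RD ι π.1 ρ))
    (hPD : ∀ (F : Type) [Field F] [NumberField F] (p : ℕ) [Fact p.Prime], 5 ≤ p →
      ¬ ((p : ℤ) ∣ NumberField.discr F) →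
      ∀ (v : HeightOneSpectrum (𝓞 F)) (hv : ((p : ℕ) : 𝓞 F) ∈ v.asIdeal)
        (ρv : FramedGaloisRep (v.adicCompletion F) (PadicAlgCl p) 2),
        let D := fontainePstAdicCompletion v p hv;
        D.IsCrystallineFramed ρv →
        (letI := D.algebra; ∀ τ : v.adicCompletion F →ₐ[ℚ_[p]] PadicAlgCl p,
          let M := D.𝔅.labelledHodgeTateWeights ρv.toGaloisRep τ.toRingHom;
          M.Nodup ∧ Multiset.card M = 2) →
        ∀ 𝔈 : PstCrystallineExtensionData D,
          letI := D.algebra; IsPotentiallyDiagonalizable 𝔈.𝔅 ρv) :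
    LiftB2Unram := by
  intro F _ _ _ p _ hp hdisc
  obtain ⟨RD, hpin, hrest⟩ := hLift F p hp hdisc
  refine ⟨RD, hpin, fun hcpt => ⟨(hrest hcpt).1, ?_⟩⟩
  intro ι ρ hirr hgeom hodd hcrys hbig hmod
  refine (hrest hcpt).2 ι ρ hirr hgeom hodd hcrys hbig hmod ?_
  intro v hv 𝔈
  have hp5 : 5 ≤ p := le_trans (by norm_num) hp
  exact hPD F p hp5 hdisc v hv (ρ.toLocal v) (hcrys v hv).1 (hcrys v hv).2 𝔈

/-- **`LiftB2Unram → LiftB2UnramSmallF`**: the small-residue-degree crux is the target with its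
extra hypothesis dropped (items `stmt-Langlands-12041` ⇒ `stmt-Langlands-12042`). [folklore] -/
theorem liftB2UnramSmallF_of_liftB2Unram (h : LiftB2Unram) : LiftB2UnramSmallF := by
  intro F _ _ _ p _ hp hdisc _hsmall
  exact h F p hp hdisc

/-- **`LiftB2Unram → LiftB2UnramLargeF`**: the large-residue-degree crux is the target with its
extra hypothesis dropped (items `stmt-Langlands-12041` ⇒ `stmt-Langlands-12043`). [folklore] -/
theorem liftB2UnramLargeF_of_liftB2Unram (h : LiftB2Unram) : LiftB2UnramLargeF := by
  intro F _ _ _ p _ hp hdisc _hlarge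
  exact h F p hp hdisc

end Summit.Langlands.Langlands.Theorems
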